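import Mathlib
import Summits.NavierStokesRegularity.NavierStokesRegularity.Theorems.EulerZoomLiouvillePowerGaugeEulerLiouvilleSelfSimilarPastStrata
import Literature.Analysis.FluidPDE.SuitableWeakRescaling
import Literature.Analysis.FluidPDE.SpaceTimeRescaling
import HarnessLib

/-!
# CENTRE TRANSFER of a past power clock, part 1: the translate of a `T₁ = T ≤ 0` clock to its collapse point is an exactly
# self-similar field about the ORIGIN whose unit cylinder is controlled by ONE origin cylinder of the member
# (crux `EulerZoomLiouville.PowerGaugeEulerLiouville` = stmt-NavierStokesRegularity-19832; line `logtime-breathers`, residue T4 «window clocks»)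

Route `EulerZoomLiouville` (NavierStokesRegularity); width seat ns-ezl-w6 g2 (cell ns-regularity-ideate, LEAD ns-typeII-p2).  A member `(u, p, H)` of
Seregin's class whose velocity is an exact power clock `u(τ, x) = (T−τ)^{γ−1} W((T−τ)^{−γ}(x − x₀))` for ALL `τ < T`, where `T ≤ 0` (the collapse
happens INSIDE the slab or AT its final time: the case `T₁ = T` of the skeleton's `IsPastSelfSimilar` / of the past clause of `IsOffRateSelfSimilar`),
is translated to its collapse point by `stPull 1 1 T x₀` (`u′(s, y) = u(T + s, x₀ + y)`).  This file proves the transport facts: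

* `ClockTransfer.isSuitableWeakSolutionOn_translate` / `…hasWeakSpatialGradientOn_translate` — `(u′, p′, H′)` is again a suitable weak Euler pair with weak
  gradient on the slab `(−∞,0) × ℝ³` (restriction to `(−∞, T)` + the tree's covariance `IsSuitableWeakSolutionOn.stRescale` with `α = β = γ = 1`);
* `ClockTransfer.translate_velocity_eq` / `…translate_pressure_eq` — `u′(τ) = selfSimilarCollapse γ 0 W τ`, `p′(τ) = selfSimilarCollapsePressure γ 0 Q τ` for
  EVERY `τ < 0`: the translate is exactly self-similar about the space–time ORIGIN on the whole slab;
* `ClockTransfer.parabolicCylinder_one_subset` — `Q_1(T, x₀) ⊆ Q_{R₀}(0, 0)` with `R₀ = ‖x₀‖ + 2 − T`: ONE origin cylinder of the member contains the unit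
  cylinder below the collapse point, hence (`…lintegral_cylinder_gradient_translate_le`, `…_pressure_…`, `…lintegral_ball_velocity_translate_le`) the
  dissipation / pressure / sliced energy of `(u′, p′, H′)` on `Q_1(0,0)` are bounded by `R₀ E(R₀)`, `R₀² D(R₀)`, `R₀ A(R₀)` of the member at the origin;
* `ClockTransfer.ae_eq_zero_of_translate_ae_eq_zero` — if `u′ = 0` a.e. on the slab and `W` is continuous then `W = 0`, so the member has a quiescent past
  and vanishes on the WHOLE slab (`Past.ae_eq_zero_of_profile_eq_zero`).

Sequel (`…ClockTransferWeights`, `…ClockTransfer`): with `γ = 1/(2+ρ′)` the own-rate weights of `(W, ∇W, Q)` are finite (reverse Tonelli on `Q_1(0,0)` +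
`W ∈ C²` near the profile origin), so by the reverse dictionary (`…ClockTransferGauges`) `(u′, p′, H′)` is an `InClass ρ′` member EXACTLY SELF-SIMILAR ABOUT
THE ORIGIN: the window `g ∈ [2/5, 1/(2+ρ))` with `T₁ = T` is THE ONE STATEMENT at `ρ′ = 1/g − 2`.
WHAT THIS IS NOT: not NS, not E — transport lemmas on the MODEL lattice (strata of the crux CLASS 19832), `--supports` stmt-19832; 19832 OPEN;
NS regularity NOT proved. [folklore]
-/

noncomputable section

-- flat `Theorems/<Route><Decl>…` files of one crux share the namespace of the crux (tree convention: `Summit.<S>.<S>.…`)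
set_option linter.dupNamespace false

open MeasureTheory Set Filter Topology Metric Function TopologicalSpace
open scoped ENNReal NNReal

namespace Summit.NavierStokesRegularity.NavierStokesRegularity.Theorems.PowerGaugeEulerLiouville

open Literature.Analysis Literature.Analysis.FunctionSpaces Literature.Analysis.FluidPDE

namespace ClockTransfer

variable {T : ℝ} {x₀ : EuclideanSpace ℝ (Fin 3)}
  {u : ℝ → EuclideanSpace ℝ (Fin 3) → EuclideanSpace ℝ (Fin 3)} {p : ℝ → EuclideanSpace ℝ (Fin 3) → ℝ}
  {H : ℝ → EuclideanSpace ℝ (Fin 3) → EuclideanSpace ℝ (Fin 3) →L[ℝ] EuclideanSpace ℝ (Fin 3)}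

/-! ### Translation to the collapse point -/

/-- The translation `(s, y) ↦ (T + s, x₀ + y)` pulls the slab `(−∞, T) × ℝ³` back to the slab `(−∞, 0) × ℝ³`. [folklore] -/
theorem stPreimage_one_slab (T : ℝ) (x₀ : EuclideanSpace ℝ (Fin 3)) :
    stPreimage 1 1 T x₀ (slab (EuclideanSpace ℝ (Fin 3)) (Iio T) isOpen_Iio) =
      slab (EuclideanSpace ℝ (Fin 3)) (Iio 0) isOpen_Iio := by
  ext ⟨s, y⟩
  simp only [SetLike.mem_coe, mem_stPreimage, stAffine_apply, mem_slab, mem_Iio, one_mul]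
  constructor <;> intro h <;> linarith

/-- **The translate of a class member to a point `(T, x₀)` with `T ≤ 0` is a suitable weak Euler pair on the slab** (restriction to
`(−∞, T)` + `IsSuitableWeakSolutionOn.stRescale` with `α = β = γ = 1`). [folklore] -/
theorem isSuitableWeakSolutionOn_translate
    (hsw : IsSuitableWeakSolutionOn (slab (EuclideanSpace ℝ (Fin 3)) (Iio 0) isOpen_Iio) 0 0 u p)
    (hT : T ≤ 0) (x₀ : EuclideanSpace ℝ (Fin 3)) :
    IsSuitableWeakSolutionOn (slab (EuclideanSpace ℝ (Fin 3)) (Iio 0) isOpen_Iio) 0 0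
      (stPull 1 1 T x₀ u) (stPull 1 1 T x₀ p) := by
  have h1 : IsSuitableWeakSolutionOn (slab (EuclideanSpace ℝ (Fin 3)) (Iio T) isOpen_Iio) 0 0 u p :=
    hsw.of_le (slab_mono (Iio_subset_Iio hT))
  have h2 := h1.stRescale (α := 1) (β := 1) (γ := 1) one_pos one_pos (by norm_num) T x₀
  have hf0 : (((1 : ℝ) ^ 2 * 1) • stPull 1 1 T x₀ (0 : ℝ → EuclideanSpace ℝ (Fin 3) → EuclideanSpace ℝ (Fin 3))) = 0 := by
    funext s y
    simp [stPull]
  rw [stPreimage_one_slab, hf0, one_smul, one_pow, one_smul, mul_zero, zero_div] at h2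
  exact h2

/-- **The translated weak gradient is a weak gradient of the translate.** [folklore] -/
theorem hasWeakSpatialGradientOn_translate
    (hH : HasWeakSpatialGradientOn (slab (EuclideanSpace ℝ (Fin 3)) (Iio 0) isOpen_Iio) u H)
    (hT : T ≤ 0) (x₀ : EuclideanSpace ℝ (Fin 3)) :
    HasWeakSpatialGradientOn (slab (EuclideanSpace ℝ (Fin 3)) (Iio 0) isOpen_Iio)
      (stPull 1 1 T x₀ u) (stPull 1 1 T x₀ H) := by
  have h1 : HasWeakSpatialGradientOn (slab (EuclideanSpace ℝ (Fin 3)) (Iio T) isOpen_Iio) u H :=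
    hH.mono (slab_mono (Iio_subset_Iio hT))
  have h2 := h1.stRescale 1 one_pos one_pos T x₀
  rw [stPreimage_one_slab, one_mul, one_smul, one_smul] at h2
  exact h2

/-- **The translate of a `T₁ = T` power clock is exactly self-similar about the origin** (velocity): for every `τ < 0`,
`u′(τ) = selfSimilarCollapse γ 0 W τ`. [folklore] -/
theorem translate_velocity_eq {γ : ℝ} {W : EuclideanSpace ℝ (Fin 3) → EuclideanSpace ℝ (Fin 3)}
    (hu : ∀ τ : ℝ, τ < T → u τ = fun x => selfSimilarCollapse γ T W τ (x - x₀)) :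
    ∀ τ : ℝ, τ < 0 → stPull 1 1 T x₀ u τ = selfSimilarCollapse γ 0 W τ := by
  intro τ hτ
  funext y
  rw [stPull_apply, hu (T + 1 * τ) (by linarith)]
  simp only [selfSimilarCollapse_apply, one_mul, one_smul, add_sub_cancel_left, sub_add_cancel_left, zero_sub]

/-- The same for the pressure ansatz: `p′(τ) = selfSimilarCollapsePressure γ 0 Q τ` for `τ < 0`. [folklore] -/
theorem translate_pressure_eq {γ : ℝ} {Q : EuclideanSpace ℝ (Fin 3) → ℝ}
    (hp : ∀ τ : ℝ, τ < T → p τ = fun x => selfSimilarCollapsePressure γ T Q τ (x - x₀)) :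
    ∀ τ : ℝ, τ < 0 → stPull 1 1 T x₀ p τ = selfSimilarCollapsePressure γ 0 Q τ := by
  intro τ hτ
  funext y
  rw [stPull_apply, hp (T + 1 * τ) (by linarith)]
  simp only [selfSimilarCollapsePressure_apply, one_mul, one_smul, add_sub_cancel_left, sub_add_cancel_left,
    zero_sub]

/-! ### One origin cylinder contains the unit cylinder below the collapse point -/

/-- The radius `R₀ = ‖x₀‖ + 2 − T` of the origin cylinder used throughout satisfies `R₀ ≥ 2` for `T ≤ 0`. [folklore] -/
theorem two_le_bigRadius (hT : T ≤ 0) (x₀ : EuclideanSpace ℝ (Fin 3)) : 2 ≤ ‖x₀‖ + 2 - T := by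
  have := norm_nonneg x₀
  linarith

/-- `R₀ = ‖x₀‖ + 2 − T > 0` for `T ≤ 0`. [folklore] -/
theorem bigRadius_pos (hT : T ≤ 0) (x₀ : EuclideanSpace ℝ (Fin 3)) : 0 < ‖x₀‖ + 2 - T := by
  have := two_le_bigRadius hT x₀; linarith

/-- **`Q_1(T, x₀) ⊆ Q_{R₀}(0, 0)`** for `T ≤ 0`, `R₀ = ‖x₀‖ + 2 − T`. [folklore] -/
theorem parabolicCylinder_one_subset (hT : T ≤ 0) (x₀ : EuclideanSpace ℝ (Fin 3)) :
    parabolicCylinder 1 ((T, x₀) : ℝ × EuclideanSpace ℝ (Fin 3)) ⊆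
      parabolicCylinder ((‖x₀‖ + 2 - T)) (0 : ℝ × EuclideanSpace ℝ (Fin 3)) := by
  intro q hq
  have hR := two_le_bigRadius hT x₀
  have hx : ‖x₀‖ + 1 < (‖x₀‖ + 2 - T) := by linarith [norm_nonneg x₀]
  rw [mem_parabolicCylinder] at hq ⊢
  rw [Prod.fst_zero, Prod.snd_zero]
  obtain ⟨⟨h1, h2⟩, h3⟩ := hq
  have hsq : (‖x₀‖ + 2 - T) ^ 2 ≥ 2 * (‖x₀‖ + 2 - T) := by nlinarith
  refine ⟨⟨?_, by linarith⟩, ?_⟩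
  · have : 1 - T ≤ (‖x₀‖ + 2 - T) := by linarith [norm_nonneg x₀]
    nlinarith
  · calc dist q.2 0 ≤ dist q.2 x₀ + dist x₀ 0 := dist_triangle _ _ _
      _ < 1 + ‖x₀‖ := by rw [dist_zero_right]; linarith
      _ < (‖x₀‖ + 2 - T) := by linarith

/-- The translation pulls `Q_1(T, x₀)` back to `Q_1(0, 0)`. [folklore] -/
theorem preimage_parabolicCylinder_one (T : ℝ) (x₀ : EuclideanSpace ℝ (Fin 3)) :
    stAffine 1 1 T x₀ ⁻¹' parabolicCylinder 1 ((T, x₀) : ℝ × EuclideanSpace ℝ (Fin 3)) =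
      parabolicCylinder 1 (0 : ℝ × EuclideanSpace ℝ (Fin 3)) := by
  ext ⟨s, y⟩
  simp only [mem_preimage, stAffine_apply, mem_parabolicCylinder, Prod.fst_zero, Prod.snd_zero, one_mul, one_smul,
    one_pow, dist_eq_norm, add_sub_cancel_left, sub_zero, zero_sub]
  constructor
  · rintro ⟨⟨h1, h2⟩, h3⟩; exact ⟨⟨by linarith, by linarith⟩, h3⟩
  · rintro ⟨⟨h1, h2⟩, h3⟩; exact ⟨⟨by linarith, by linarith⟩, h3⟩

/-- **Dissipation of the translated gradient on the unit cylinder is controlled by ONE origin cylinder of the member:**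
`∫_{Q_1(0,0)} |H′|²_F ≤ R₀ · E(R₀; 0; H)`. [folklore] -/
theorem lintegral_cylinder_gradient_translate_le (hT : T ≤ 0) (x₀ : EuclideanSpace ℝ (Fin 3))
    (H : ℝ → EuclideanSpace ℝ (Fin 3) → EuclideanSpace ℝ (Fin 3) →L[ℝ] EuclideanSpace ℝ (Fin 3)) :
    ∫⁻ q in parabolicCylinder 1 (0 : ℝ × EuclideanSpace ℝ (Fin 3)),
        ENNReal.ofReal (frobeniusNormSq (stPull 1 1 T x₀ H q.1 q.2)) ≤
      ENNReal.ofReal ((‖x₀‖ + 2 - T)) * cknE ((‖x₀‖ + 2 - T)) (0 : ℝ × EuclideanSpace ℝ (Fin 3)) H := by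
  have hR := bigRadius_pos hT x₀
  have h1 := setLIntegral_frobeniusNormSq_stRescale (E := EuclideanSpace ℝ (Fin 3)) one_pos one_pos T x₀ 1 H
    (parabolicCylinder 1 ((T, x₀) : ℝ × EuclideanSpace ℝ (Fin 3)))
  rw [preimage_parabolicCylinder_one, one_smul, one_pow, finrank_euclideanSpace_fin, one_pow, mul_one,
    inv_one, ENNReal.ofReal_one, one_mul, one_mul] at h1
  rw [h1]
  have hA0 : ENNReal.ofReal ((‖x₀‖ + 2 - T)) ≠ 0 := by rw [ENNReal.ofReal_ne_zero_iff]; exact hR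
  calc ∫⁻ q in parabolicCylinder 1 ((T, x₀) : ℝ × EuclideanSpace ℝ (Fin 3)), ENNReal.ofReal (frobeniusNormSq (H q.1 q.2))
      ≤ ∫⁻ q in parabolicCylinder ((‖x₀‖ + 2 - T)) (0 : ℝ × EuclideanSpace ℝ (Fin 3)),
          ENNReal.ofReal (frobeniusNormSq (H q.1 q.2)) := lintegral_mono_set (parabolicCylinder_one_subset hT x₀)
    _ = ENNReal.ofReal ((‖x₀‖ + 2 - T)) * cknE ((‖x₀‖ + 2 - T)) (0 : ℝ × EuclideanSpace ℝ (Fin 3)) H := by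
        unfold cknE
        rw [← mul_assoc, ENNReal.mul_inv_cancel hA0 ENNReal.ofReal_ne_top, one_mul]

/-- **Pressure of the translate on the unit cylinder:** `∫_{Q_1(0,0)} |p′|^{3/2} ≤ R₀² · D(R₀; 0; p)`. [folklore] -/
theorem lintegral_cylinder_pressure_translate_le (hT : T ≤ 0) (x₀ : EuclideanSpace ℝ (Fin 3))
    (p : ℝ → EuclideanSpace ℝ (Fin 3) → ℝ) :
    ∫⁻ q in parabolicCylinder 1 (0 : ℝ × EuclideanSpace ℝ (Fin 3)), ‖stPull 1 1 T x₀ p q.1 q.2‖ₑ ^ (3 / 2 : ℝ) ≤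
      ENNReal.ofReal ((‖x₀‖ + 2 - T)) ^ 2 * cknD ((‖x₀‖ + 2 - T)) (0 : ℝ × EuclideanSpace ℝ (Fin 3)) p := by
  have hR := bigRadius_pos hT x₀
  have h1 := setLIntegral_enorm_rpow_stRescale (E := EuclideanSpace ℝ (Fin 3)) one_pos one_pos T x₀ 1 p
    (parabolicCylinder 1 ((T, x₀) : ℝ × EuclideanSpace ℝ (Fin 3))) (r := 3 / 2) (by norm_num)
  rw [preimage_parabolicCylinder_one, one_smul, finrank_euclideanSpace_fin, one_pow, mul_one, inv_one,
    ENNReal.ofReal_one, enorm_one, ENNReal.one_rpow, one_mul, one_mul] at h1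
  rw [h1]
  have hA0 : ENNReal.ofReal ((‖x₀‖ + 2 - T)) ^ 2 ≠ 0 := pow_ne_zero _ (by rw [ENNReal.ofReal_ne_zero_iff]; exact hR)
  have hAtop : ENNReal.ofReal ((‖x₀‖ + 2 - T)) ^ 2 ≠ ⊤ := ENNReal.pow_ne_top ENNReal.ofReal_ne_top
  calc ∫⁻ q in parabolicCylinder 1 ((T, x₀) : ℝ × EuclideanSpace ℝ (Fin 3)), ‖p q.1 q.2‖ₑ ^ (3 / 2 : ℝ)
      ≤ ∫⁻ q in parabolicCylinder ((‖x₀‖ + 2 - T)) (0 : ℝ × EuclideanSpace ℝ (Fin 3)), ‖p q.1 q.2‖ₑ ^ (3 / 2 : ℝ) :=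
        lintegral_mono_set (parabolicCylinder_one_subset hT x₀)
    _ = ENNReal.ofReal ((‖x₀‖ + 2 - T)) ^ 2 * cknD ((‖x₀‖ + 2 - T)) (0 : ℝ × EuclideanSpace ℝ (Fin 3)) p := by
        unfold cknD
        rw [← mul_assoc, ENNReal.mul_inv_cancel hA0 hAtop, one_mul]

/-- **Sliced energy of the translate on the unit ball:** for every `t ∈ (−1, 0)`, `∫_{B_1} ‖u′(t)‖² ≤ R₀ · A(R₀; 0; u)`. [folklore] -/
theorem lintegral_ball_velocity_translate_le (hT : T ≤ 0) (x₀ : EuclideanSpace ℝ (Fin 3))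
    (u : ℝ → EuclideanSpace ℝ (Fin 3) → EuclideanSpace ℝ (Fin 3)) {t : ℝ} (ht : t ∈ Ioo (-1 : ℝ) 0) :
    ∫⁻ x in ball (0 : EuclideanSpace ℝ (Fin 3)) 1, ‖stPull 1 1 T x₀ u t x‖ₑ ^ 2 ≤
      ENNReal.ofReal ((‖x₀‖ + 2 - T)) * cknA ((‖x₀‖ + 2 - T)) (0 : ℝ × EuclideanSpace ℝ (Fin 3)) u := by
  have hR := bigRadius_pos hT x₀
  have hR2 := two_le_bigRadius hT x₀
  -- translate the ball
  have hpre : (fun y : EuclideanSpace ℝ (Fin 3) => x₀ + (1 : ℝ) • y) ⁻¹' ball x₀ 1 = ball 0 1 := by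
    rw [space_affine_preimage_ball one_pos]; simp
  have h1 : ∫⁻ x in ball (0 : EuclideanSpace ℝ (Fin 3)) 1, ‖stPull 1 1 T x₀ u t x‖ₑ ^ 2 =
      ∫⁻ x in ball x₀ 1, ‖u (T + t) x‖ₑ ^ 2 := by
    have e : (fun x : EuclideanSpace ℝ (Fin 3) => ‖stPull 1 1 T x₀ u t x‖ₑ ^ 2) =
        fun y => (fun x => ‖u (T + t) x‖ₑ ^ 2) (x₀ + (1 : ℝ) • y) := by
      funext y; simp only [stPull_apply, one_mul]
    rw [e, ← hpre, setLIntegral_preimage_comp_space_affine one_pos x₀ (fun x => ‖u (T + t) x‖ₑ ^ 2) (ball x₀ 1),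
      finrank_euclideanSpace_fin, one_pow, inv_one, ENNReal.ofReal_one, one_mul]
  rw [h1]
  -- the ball `B(x₀, 1)` inside `B(0, R₀)`, the time `T + t` inside `(−R₀², 0)`
  have hsub : ball x₀ 1 ⊆ ball (0 : EuclideanSpace ℝ (Fin 3)) ((‖x₀‖ + 2 - T)) := by
    intro x hx
    rw [mem_ball, dist_zero_right] at *
    calc ‖x‖ = dist x 0 := (dist_zero_right x).symm
      _ ≤ dist x x₀ + dist x₀ 0 := dist_triangle _ _ _
      _ < 1 + ‖x₀‖ := by rw [dist_zero_right]; linarith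
      _ < (‖x₀‖ + 2 - T) := by linarith [norm_nonneg x₀]
  have hτ : T + t ∈ Ioo ((0 : ℝ × EuclideanSpace ℝ (Fin 3)).1 - (‖x₀‖ + 2 - T) ^ 2)
      (0 : ℝ × EuclideanSpace ℝ (Fin 3)).1 := by
    simp only [Prod.fst_zero, zero_sub, mem_Ioo]
    have hsq : (‖x₀‖ + 2 - T) ^ 2 ≥ 2 * (‖x₀‖ + 2 - T) := by nlinarith
    have : 1 - T ≤ (‖x₀‖ + 2 - T) := by linarith [norm_nonneg x₀]
    exact ⟨by nlinarith [ht.1], by linarith [ht.2]⟩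
  have hslice : (ENNReal.ofReal ((‖x₀‖ + 2 - T)))⁻¹ *
      ∫⁻ x in ball (0 : EuclideanSpace ℝ (Fin 3)) ((‖x₀‖ + 2 - T)), ‖u (T + t) x‖ₑ ^ 2 ≤
      cknA ((‖x₀‖ + 2 - T)) (0 : ℝ × EuclideanSpace ℝ (Fin 3)) u := by
    unfold cknA
    exact le_iSup₂ (f := fun s (_ : s ∈ Ioo ((0 : ℝ × EuclideanSpace ℝ (Fin 3)).1 - (‖x₀‖ + 2 - T) ^ 2)
        (0 : ℝ × EuclideanSpace ℝ (Fin 3)).1) =>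
        (ENNReal.ofReal ((‖x₀‖ + 2 - T)))⁻¹ *
          ∫⁻ x in ball (0 : ℝ × EuclideanSpace ℝ (Fin 3)).2 ((‖x₀‖ + 2 - T)), ‖u s x‖ₑ ^ 2) (T + t) hτ
  have hA0 : ENNReal.ofReal ((‖x₀‖ + 2 - T)) ≠ 0 := by rw [ENNReal.ofReal_ne_zero_iff]; exact hR
  calc ∫⁻ x in ball x₀ 1, ‖u (T + t) x‖ₑ ^ 2
      ≤ ∫⁻ x in ball (0 : EuclideanSpace ℝ (Fin 3)) ((‖x₀‖ + 2 - T)), ‖u (T + t) x‖ₑ ^ 2 := lintegral_mono_set hsub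
    _ = ENNReal.ofReal ((‖x₀‖ + 2 - T)) * ((ENNReal.ofReal ((‖x₀‖ + 2 - T)))⁻¹ *
          ∫⁻ x in ball (0 : EuclideanSpace ℝ (Fin 3)) ((‖x₀‖ + 2 - T)), ‖u (T + t) x‖ₑ ^ 2) := by
        rw [← mul_assoc, ENNReal.mul_inv_cancel hA0 ENNReal.ofReal_ne_top, one_mul]
    _ ≤ ENNReal.ofReal ((‖x₀‖ + 2 - T)) * cknA ((‖x₀‖ + 2 - T)) (0 : ℝ × EuclideanSpace ℝ (Fin 3)) u := by gcongr

/-! ### Back to the member: triviality of the translate kills the member -/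

/-- If an exactly self-similar field about the origin with CONTINUOUS profile vanishes a.e. on the slab, its profile is zero. [folklore] -/
theorem profile_eq_zero_of_ae_eq_zero {γ : ℝ} {v : ℝ → EuclideanSpace ℝ (Fin 3) → EuclideanSpace ℝ (Fin 3)}
    {W : EuclideanSpace ℝ (Fin 3) → EuclideanSpace ℝ (Fin 3)} (hW : Continuous W)
    (hv : ∀ τ : ℝ, τ < 0 → v τ = selfSimilarCollapse γ 0 W τ)
    (h0 : uncurry v =ᵐ[volume.restrict (Iio (0 : ℝ) ×ˢ (univ : Set (EuclideanSpace ℝ (Fin 3))))] 0) : W = 0 := by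
  -- slices: for a.e. `τ < 0`, `v τ = 0` a.e.
  rw [Measure.volume_eq_prod, ← Measure.prod_restrict, Measure.restrict_univ] at h0
  have h1 := Measure.ae_ae_of_ae_prod h0
  have h2 : ∀ᵐ τ ∂((volume : Measure ℝ).restrict (Iio (0 : ℝ))), τ < 0 := ae_restrict_mem measurableSet_Iio
  haveI : (ae ((volume : Measure ℝ).restrict (Iio (0 : ℝ)))).NeBot := by
    rw [ae_neBot, Ne, Measure.restrict_eq_zero]; simp
  obtain ⟨τ, hτ, hτ0⟩ := (h1.and h2).exists
  have hs : 0 < -τ := neg_pos.2 hτ0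
  set d : ℝ := (-τ) ^ (-γ) with hd
  have hd0 : d ≠ 0 := (Real.rpow_pos_of_pos hs _).ne'
  have hc0 : (-τ) ^ (γ - 1) ≠ 0 := (Real.rpow_pos_of_pos hs _).ne'
  -- `W (d • x) = 0` for a.e. `x`
  have h3 : ∀ᵐ x ∂(volume : Measure (EuclideanSpace ℝ (Fin 3))), W (d • x) = 0 := by
    filter_upwards [hτ] with x hx
    have hx' : v τ x = 0 := hx
    rw [hv τ hτ0, selfSimilarCollapse_apply, zero_sub, smul_eq_zero] at hx'
    exact hx'.resolve_left hc0
  -- undo the dilation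
  have h4 : ∀ᵐ y ∂(volume : Measure (EuclideanSpace ℝ (Fin 3))), W y = 0 := by
    have := (quasiMeasurePreserving_smul (inv_ne_zero hd0)).ae_eq_comp
      (show (fun x : EuclideanSpace ℝ (Fin 3) => W (d • x)) =ᵐ[volume] fun _ => (0 : EuclideanSpace ℝ (Fin 3)) from h3)
    filter_upwards [this] with y hy
    simpa [smul_smul, mul_inv_cancel₀ hd0] using hy
  -- a continuous a.e.-zero function is zero
  have h5 : W =ᵐ[volume] (0 : EuclideanSpace ℝ (Fin 3) → EuclideanSpace ℝ (Fin 3)) := h4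
  exact Continuous.ae_eq_iff_eq volume hW continuous_const |>.1 h5

/-- **TRIVIALITY TRANSFERS BACK.**  Let `(u, p, H)` be a class member (crux hypotheses verbatim, any `ρ ≥ 0`) whose velocity is an exact
power clock of rate `γ` about `(T, x₀)` for all `τ < T` (any `T`), with CONTINUOUS profile `W`.  If the translate `u′ = stPull 1 1 T x₀ u` vanishes
a.e. on the slab, then `W = 0`, the member vanishes for `τ < T`, its past is quiescent, and it vanishes a.e. on the WHOLE slab
(`Past.ae_eq_zero_of_profile_eq_zero`, i.e. the filled stub `stub_quiescentPast`). [folklore] -/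
theorem ae_eq_zero_of_translate_ae_eq_zero {ρ γ : ℝ} (hρ : 0 ≤ ρ) {c : ℝ≥0}
    (hsw : IsSuitableWeakSolutionOn (slab (EuclideanSpace ℝ (Fin 3)) (Iio 0) isOpen_Iio) 0 0 u p)
    (hH : HasWeakSpatialGradientOn (slab (EuclideanSpace ℝ (Fin 3)) (Iio 0) isOpen_Iio) u H)
    (hgauge : ∀ a : ℝ, 0 < a →
      ENNReal.ofReal (a ^ (2 * ρ)) * cknA a (0 : ℝ × EuclideanSpace ℝ (Fin 3)) u +
          ENNReal.ofReal (a ^ ρ) * cknE a (0 : ℝ × EuclideanSpace ℝ (Fin 3)) H +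
        ENNReal.ofReal (a ^ (2 * ρ)) * cknD a (0 : ℝ × EuclideanSpace ℝ (Fin 3)) p ≤ (c : ℝ≥0∞))
    {W : EuclideanSpace ℝ (Fin 3) → EuclideanSpace ℝ (Fin 3)} (hW : Continuous W)
    (hu : ∀ τ : ℝ, τ < T → u τ = fun x => selfSimilarCollapse γ T W τ (x - x₀))
    (h0 : uncurry (stPull 1 1 T x₀ u) =ᵐ[volume.restrict (Iio (0 : ℝ) ×ˢ (univ : Set (EuclideanSpace ℝ (Fin 3))))] 0) :
    uncurry u =ᵐ[volume.restrict (Iio (0 : ℝ) ×ˢ (univ : Set (EuclideanSpace ℝ (Fin 3))))] 0 :=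
  Past.ae_eq_zero_of_profile_eq_zero (T₁ := T) hρ hsw hH hgauge hu
    (profile_eq_zero_of_ae_eq_zero hW (translate_velocity_eq hu) h0)

end ClockTransfer

end Summit.NavierStokesRegularity.NavierStokesRegularity.Theorems.PowerGaugeEulerLiouville
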